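import Mathlib
import Literature.NumberTheory.LFunctions.Zhang2022.Section7KappaLocalBounds
import HarnessLib

/-!
# Zhang (2022) §7 p. 40: the "simple bounds" for `κ̃(d₁;m,s)` and `λ(m,s)` — node `Z22:§7.u046`, DISCHARGED

Topic `Literature/NumberTheory/LFunctions/Zhang2022` (Landau–Siegel audit tree; verdict-neutral).
Y. Zhang, *Discrete mean estimates and the Landau–Siegel zero*, arXiv:2211.02515v1 (2022)
[Zhang2022LandauSiegel] — **an unrefereed manuscript under adjudication.** Cell siegel-zhang
(D-0069), DISCHARGE of one proof-internal step of Proposition 7.1 (c) at the Mellin integral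
(7.19) (§7 p. 40, tex L2105):

> By the simple bounds `|κ̃(d₁;d₂k,s)| ≤ τ₅(d₁)∏_{q∣d₁}|1 + c/q^σ|`, `|λ(m,s)| ≤ ∏_{q∣m}|1 + c/q^σ|`
> for `σ > 9/10`, we can move the contour of integration in (7.19) …

(`κ̃(d;m,s) = Σ_{h∈𝔫(d),(h,m)=1} κ(dh)h^{−s}`, `λ(m,s) = ∏_{q∣m}(1−q^{−s−β₁})(1−q^{−s−β₂})(1−q^{−s−β₃})
/(1−q^{−s})`, §7 p. 32; `c` an unspecified absolute constant). The typed claim is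
`Section7dStatements.Step7u046 c'` (L2-t5, p412033; DAG node `Z22:§7.u046`; `τ₅ = tauFive = ζ^5`).
**This file proves it with `c = 200`** (prime-power and numerical ingredients in the companion
`Section7KappaLocalBounds.lean`): `Section7dStatements.step7u046_holds : ∀ c′, Step7u046 c′`
— uniformly in `D` (all `D : ℕ`), in `d₁, m ≥ 1`, in `σ > 9/10`, and in the parameter `c′` of
(2.13), because the shifts `β_j` are purely imaginary. Theorems only; 0 new facts; no numerics
beyond the elementary `2^{−9/10} ≤ 3/5`.

## Proof

* `λ`: each factor has norm `≤ (1 + x)³/(1 − x)` with `x = q^{−σ} ∈ (0, 3/5]` (`|q^{−s−β_j}| =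
  q^{−σ}`), and `(1 + x)³ ≤ (1 + 200x)(1 − x)` on `[0, 3/5]` (`norm_lam_factor_le`, `norm_lam_le`).
* `κ̃`: `|κ(q^k)| ≤ C(k+3,3) = τ₄(q^k)` (`κ = n^{−ib₁} ∗ n^{−ib₂} ∗ n^{−ib₃} ∗ μ`, three hockey-stick
  sums: `norm_kappa_prime_pow_le_choose`), hence `|κ(n)| ≤ τ₄(n)` (`norm_kappa_le_tau4`) and, prime
  by prime, `τ₄(d₁h) ≤ τ₄(d₁)τ₄(h)` (`tau4_mul_le`, from `C(a+e+3,3) ≤ C(a+3,3)C(e+3,3)`). So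
  `|κ̃(d₁;m,s)| ≤ τ₄(d₁) Σ_{h∈𝔫(d₁)} τ₄(h)h^{−σ} = τ₄(d₁)∏_{q∣d₁}(1 − q^{−σ})^{−4}` — an Euler
  product over the `d₁.primeFactors`-factored numbers (Mathlib's
  `EulerProduct.summable_and_hasSum_factoredNumbers_prod_filter_prime_tsum` with the generating
  function `Σ_e C(e+3,3)x^e = (1−x)^{−4}`, `tsum_choose_mul_geometric_of_norm_lt_one`), and
  `(1 − x)^{−4} ≤ 1 + 200x` on `[0, 3/5]`, `τ₄(d₁) ≤ τ₅(d₁)` (`norm_kappaTilde_le`).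

WHAT THIS IS NOT: any statement about Theorems 1–2 of the manuscript or about Landau–Siegel zeros;
a discharge of the contour move itself (`Step7u047`/`Step7u049`), which USES these bounds.

## References

* Y. Zhang, arXiv:2211.02515v1 (2022), §7 p. 32 (`κ̃`, `λ`), p. 34 (`κ`), p. 40 (the "simple
  bounds"), tex L1789–L1797, L2105. [cite: Zhang2022LandauSiegel, §7 p.40]
-/

noncomputable section

open Complex ArithmeticFunction Finset

namespace Literature.NumberTheory.LFunctions.Zhang2022.KappaBounds

open MeanSquareMajorant (kappa isMultiplicative_kappa)

/-! ### §1. The bound for `λ(m,s)` -/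

section Lam

variable (c' : ℝ) (D : ℕ)

/-- `Re β₁ = 0`. [cite: Zhang2022LandauSiegel, §2 (2.13)] -/
private theorem beta1_re : (Skeleton.beta1 c' D).re = 0 := by simp [Skeleton.beta1]

/-- `Re β₂ = 0`. [cite: Zhang2022LandauSiegel, §2 (2.13)] -/
private theorem beta2_re : (Skeleton.beta2 c' D).re = 0 := by simp [Skeleton.beta2]

/-- `Re β₃ = 0`. [cite: Zhang2022LandauSiegel, §2 (2.13)] -/
private theorem beta3_re : (Skeleton.beta3 c' D).re = 0 := by simp [Skeleton.beta3]

/-- `‖q^{−(s+β)}‖ = q^{−σ}` for purely imaginary `β`. [folklore] -/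
private theorem norm_cpow_neg_add {q : ℕ} (hq : q.Prime) (s β : ℂ) (hβ : β.re = 0) :
    ‖(q : ℂ) ^ (-(s + β))‖ = (q : ℝ) ^ (-s.re) := by
  rw [Complex.norm_natCast_cpow_of_pos hq.pos]
  simp [hβ]

/-- **The local `λ`-factor**: for a prime `q` and `σ > 9/10`,
`‖(1−q^{−s−β₁})(1−q^{−s−β₂})(1−q^{−s−β₃})/(1−q^{−s})‖ ≤ 1 + 200 q^{−σ}`.
[cite: Zhang2022LandauSiegel, §7 p.40, tex L2105] -/
theorem norm_lam_factor_le {q : ℕ} (hq : q.Prime) {s : ℂ} (hs : 9 / 10 < s.re) :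
    ‖(1 - (q : ℂ) ^ (-(s + Skeleton.beta1 c' D))) * (1 - (q : ℂ) ^ (-(s + Skeleton.beta2 c' D))) *
        (1 - (q : ℂ) ^ (-(s + Skeleton.beta3 c' D))) / (1 - (q : ℂ) ^ (-s))‖ ≤
      1 + 200 * (q : ℝ) ^ (-s.re) := by
  obtain ⟨hx0, hx1⟩ := rpow_neg_range hq hs
  set x : ℝ := (q : ℝ) ^ (-s.re) with hx
  have n1 := norm_cpow_neg_add hq s _ (beta1_re c' D)
  have n2 := norm_cpow_neg_add hq s _ (beta2_re c' D)
  have n3 := norm_cpow_neg_add hq s _ (beta3_re c' D)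
  have n0 : ‖(q : ℂ) ^ (-s)‖ = x := by rw [Complex.norm_natCast_cpow_of_pos hq.pos, Complex.neg_re]
  have hup : ∀ {w : ℂ}, ‖w‖ = x → ‖1 - w‖ ≤ 1 + x := fun {w} hw => by
    calc ‖1 - w‖ ≤ ‖(1 : ℂ)‖ + ‖w‖ := norm_sub_le _ _
      _ = 1 + x := by rw [norm_one, hw]
  have hdown : 1 - x ≤ ‖1 - (q : ℂ) ^ (-s)‖ := by
    calc 1 - x = ‖(1 : ℂ)‖ - ‖(q : ℂ) ^ (-s)‖ := by rw [norm_one, n0]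
      _ ≤ ‖1 - (q : ℂ) ^ (-s)‖ := norm_sub_norm_le _ _
  have hpos : 0 < 1 - x := by linarith
  rw [norm_div, norm_mul, norm_mul, div_le_iff₀ (lt_of_lt_of_le hpos hdown)]
  calc ‖1 - (q : ℂ) ^ (-(s + Skeleton.beta1 c' D))‖ * ‖1 - (q : ℂ) ^ (-(s + Skeleton.beta2 c' D))‖ *
        ‖1 - (q : ℂ) ^ (-(s + Skeleton.beta3 c' D))‖
      ≤ (1 + x) * (1 + x) * (1 + x) := by
        apply mul_le_mul (mul_le_mul (hup n1) (hup n2) (norm_nonneg _) (by linarith)) (hup n3)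
          (norm_nonneg _) (by positivity)
    _ = (1 + x) ^ 3 := by ring
    _ ≤ (1 + 200 * x) * (1 - x) := cube_le hx0.le hx1
    _ ≤ (1 + 200 * x) * ‖1 - (q : ℂ) ^ (-s)‖ := mul_le_mul_of_nonneg_left hdown (by positivity)

/-- **The bound for `λ(m,s)`**: `‖λ(m,s)‖ ≤ ∏_{q∣m} |1 + 200/q^σ|` for `σ > 9/10` (all `m`, all `D`).
[cite: Zhang2022LandauSiegel, §7 p.40, tex L2105] -/
theorem norm_lam_le (m : ℕ) {s : ℂ} (hs : 9 / 10 < s.re) :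
    ‖Skeleton.lam c' D m s‖ ≤ ∏ q ∈ m.primeFactors, |1 + 200 / (q : ℝ) ^ s.re| := by
  rw [Skeleton.lam, norm_prod]
  refine Finset.prod_le_prod (fun _ _ => norm_nonneg _) fun q hq => ?_
  have hq' : q.Prime := Nat.prime_of_mem_primeFactors hq
  have hq0 : (0 : ℝ) < q := by exact_mod_cast hq'.pos
  have e : (1 : ℝ) + 200 / (q : ℝ) ^ s.re = 1 + 200 * (q : ℝ) ^ (-s.re) := by
    rw [Real.rpow_neg hq0.le, div_eq_mul_inv]
  rw [e, abs_of_pos (by have := (rpow_neg_range hq' hs).1; positivity)]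
  exact norm_lam_factor_le c' D hq' hs

end Lam

/-! ### §2. The bound for `κ̃(d₁;m,s)` -/

section KappaTilde

variable (c' : ℝ) (D : ℕ)

/-- `((q^e) : ℝ)^{−σ} = (q^{−σ})^e`. [folklore] -/
private theorem rpow_natPow_neg (q e : ℕ) (σ : ℝ) :
    (((q ^ e : ℕ) : ℝ)) ^ (-σ) = ((q : ℝ) ^ (-σ)) ^ e := by
  rw [Nat.cast_pow, ← Real.rpow_natCast, ← Real.rpow_mul (Nat.cast_nonneg q), mul_comm,
    Real.rpow_mul (Nat.cast_nonneg q), Real.rpow_natCast]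

/-- **Euler product of the majorant**: for `σ > 9/10` and `d ≥ 1`,
`Σ_{h ∈ 𝔫(d)} τ₄(h) h^{−σ} = ∏_{q∣d} (1 − q^{−σ})^{−4}` (as a `HasSum` over the indicator of the
`d.primeFactors`-factored numbers). [folklore] -/
private theorem hasSum_tau4_rpow {σ : ℝ} (hσ : 9 / 10 < σ) (d : ℕ) :
    HasSum ((Nat.factoredNumbers d.primeFactors).indicator fun h : ℕ =>
        (((ArithmeticFunction.zeta ^ 4 : ArithmeticFunction ℕ) h : ℕ) : ℝ) * (h : ℝ) ^ (-σ))
      (∏ q ∈ d.primeFactors, 1 / (1 - (q : ℝ) ^ (-σ)) ^ 4) := by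
  set F : ℕ → ℝ := fun h =>
    (((ArithmeticFunction.zeta ^ 4 : ArithmeticFunction ℕ) h : ℕ) : ℝ) * (h : ℝ) ^ (-σ) with hF
  have hF1 : F 1 = 1 := by
    simp only [hF, (ArithmeticFunction.isMultiplicative_zeta.pow (k := 4)).map_one, Nat.cast_one, Real.one_rpow, mul_one]
  have hmul : ∀ {a b : ℕ}, Nat.Coprime a b → F (a * b) = F a * F b := fun {a b} hab => by
    simp only [hF]
    rw [(ArithmeticFunction.isMultiplicative_zeta.pow (k := 4)).map_mul_of_coprime hab, Nat.cast_mul, Nat.cast_mul,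
      Real.mul_rpow (Nat.cast_nonneg a) (Nat.cast_nonneg b)]
    ring
  have hloc : ∀ {q : ℕ}, q.Prime → ∀ e : ℕ,
      F (q ^ e) = (((e + 3).choose 3 : ℕ) : ℝ) * ((q : ℝ) ^ (-σ)) ^ e := fun {q} hq e => by
    simp only [hF]
    rw [show (4 : ℕ) = 3 + 1 from rfl, zeta_pow_succ_prime_pow hq 3, rpow_natPow_neg]
  have hx : ∀ {q : ℕ}, q.Prime → ‖(q : ℝ) ^ (-σ)‖ < 1 := fun {q} hq => by
    obtain ⟨h0, h1⟩ := rpow_neg_range hq hσ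
    rw [Real.norm_of_nonneg h0.le]; linarith
  have hsum : ∀ {q : ℕ}, q.Prime → Summable fun e : ℕ => ‖F (q ^ e)‖ := fun {q} hq => by
    have := (summable_choose_mul_geometric_of_norm_lt_one 3 (hx hq)).norm
    refine this.congr fun e => ?_
    rw [hloc hq]
  have key := (EulerProduct.summable_and_hasSum_factoredNumbers_prod_filter_prime_tsum hF1 hmul
    hsum d.primeFactors).2
  have hfilter : d.primeFactors.filter Nat.Prime = d.primeFactors :=
    Finset.filter_true_of_mem fun q hq => Nat.prime_of_mem_primeFactors hq
  have hprod : (∏ q ∈ d.primeFactors, ∑' e : ℕ, F (q ^ e)) =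
      ∏ q ∈ d.primeFactors, 1 / (1 - (q : ℝ) ^ (-σ)) ^ 4 := by
    refine Finset.prod_congr rfl fun q hq => ?_
    have hq' := Nat.prime_of_mem_primeFactors hq
    rw [tsum_congr (hloc hq'), tsum_choose_mul_geometric_of_norm_lt_one 3 (hx hq')]
  rw [hfilter, hprod] at key
  exact hasSum_subtype_iff_indicator.mp key

/-- For `σ > 9/10`: `(1 − q^{−σ})^{−4} ≤ 1 + 200 q^{−σ}`. [folklore] -/
private theorem inv_quartic_le {q : ℕ} (hq : q.Prime) {σ : ℝ} (hσ : 9 / 10 < σ) :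
    1 / (1 - (q : ℝ) ^ (-σ)) ^ 4 ≤ 1 + 200 * (q : ℝ) ^ (-σ) := by
  obtain ⟨h0, h1⟩ := rpow_neg_range hq hσ
  have hpos : 0 < (1 - (q : ℝ) ^ (-σ)) ^ 4 := pow_pos (by linarith) 4
  rw [div_le_iff₀ hpos]
  exact one_le_quartic h0.le h1

/-- **The bound for `κ̃(d₁;m,s)`**: `‖κ̃(d₁;m,s)‖ ≤ τ₅(d₁) ∏_{q∣d₁} |1 + 200/q^σ|` for `σ > 9/10`,
`d₁ ≥ 1` (all `m`, all `D`): `|κ(d₁h)| ≤ τ₄(d₁h) ≤ τ₄(d₁)τ₄(h)`, the Euler product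
`Σ_{h∈𝔫(d₁)} τ₄(h)h^{−σ} = ∏_{q∣d₁}(1 − q^{−σ})^{−4}`, and `τ₄ ≤ τ₅`.
[cite: Zhang2022LandauSiegel, §7 p.40, tex L2105] -/
theorem norm_kappaTilde_le {d₁ : ℕ} (hd₁ : d₁ ≠ 0) (m : ℕ) {s : ℂ} (hs : 9 / 10 < s.re) :
    ‖Skeleton.kappaTilde c' D d₁ m s‖ ≤
      Section7dStatements.tauFive d₁ * ∏ q ∈ d₁.primeFactors, |1 + 200 / (q : ℝ) ^ s.re| := by
  set S := d₁.primeFactors with hS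
  set T4 : ℕ → ℕ := fun n => (ArithmeticFunction.zeta ^ 4 : ArithmeticFunction ℕ) n with hT4
  set F : ℕ → ℝ := fun h => ((T4 h : ℕ) : ℝ) * (h : ℝ) ^ (-s.re) with hF
  have hsumF := hasSum_tau4_rpow (σ := s.re) hs d₁
  -- the majorant
  set g : ℕ → ℝ := fun h => ((T4 d₁ : ℕ) : ℝ) * (Nat.factoredNumbers S).indicator F h with hg
  have hgsum : HasSum g (((T4 d₁ : ℕ) : ℝ) * ∏ q ∈ S, 1 / (1 - (q : ℝ) ^ (-s.re)) ^ 4) :=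
    hsumF.mul_left _
  have hF0 : ∀ h, 0 ≤ F h := fun h => by positivity
  have hg0 : ∀ h, 0 ≤ g h := fun h =>
    mul_nonneg (Nat.cast_nonneg _) (Set.indicator_nonneg (fun _ _ => hF0 _) _)
  -- the summand of κ̃ (read off the definition, with its own decidability instances) and its
  -- termwise bound
  obtain ⟨a, ha, hle⟩ : ∃ a : ℕ → ℂ, Skeleton.kappaTilde c' D d₁ m s = ∑' h, a h ∧
      ∀ h, ‖a h‖ ≤ g h := by
    refine ⟨_, rfl, fun h => ?_⟩
    by_cases hh : h ∈ Skeleton.nset d₁ ∧ Nat.Coprime h m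
    · have h0 : h ≠ 0 := hh.1.1.ne'
      have hmem : h ∈ Nat.factoredNumbers S :=
        Nat.mem_factoredNumbers_iff_primeFactors_subset.mpr ⟨h0, fun q hq => by
          have hq' := Nat.mem_primeFactors.mp hq
          exact Nat.mem_primeFactors.mpr ⟨hq'.1, hh.1.2 q hq'.1 hq'.2.1, hd₁⟩⟩
      rw [if_pos hh]
      simp only [hg, Set.indicator_of_mem hmem, hF]
      rw [norm_div, Complex.norm_natCast_cpow_of_pos (Nat.pos_of_ne_zero h0), div_eq_mul_inv,
        ← Real.rpow_neg (Nat.cast_nonneg h), ← mul_assoc]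
      refine mul_le_mul_of_nonneg_right ?_ (by positivity)
      calc ‖Skeleton.kappaZ c' D (d₁ * h)‖ ≤ ((T4 (d₁ * h) : ℕ) : ℝ) :=
            norm_kappa_le_tau4 _ _ _ (mul_ne_zero hd₁ h0)
        _ ≤ ((T4 d₁ * T4 h : ℕ) : ℝ) := by exact_mod_cast tau4_mul_le hd₁ h0
        _ = ((T4 d₁ : ℕ) : ℝ) * ((T4 h : ℕ) : ℝ) := Nat.cast_mul _ _
    · rw [if_neg hh, norm_zero]
      exact hg0 h
  have hasum : Summable fun h => ‖a h‖ :=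
    Summable.of_nonneg_of_le (fun _ => norm_nonneg _) hle hgsum.summable
  -- assemble
  have step1 : ‖Skeleton.kappaTilde c' D d₁ m s‖ ≤ ∑' h, g h := by
    rw [ha]
    exact (norm_tsum_le_tsum_norm hasum).trans
      (Summable.tsum_le_tsum hle hasum hgsum.summable)
  rw [hgsum.tsum_eq] at step1
  refine step1.trans (mul_le_mul ?_ ?_ (by positivity) (Nat.cast_nonneg _))
  · exact_mod_cast tau4_le_tauFive hd₁
  · refine Finset.prod_le_prod (fun _ _ => by positivity) fun q hq => ?_
    have hq' : q.Prime := Nat.prime_of_mem_primeFactors hq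
    have hq0 : (0 : ℝ) < q := by exact_mod_cast hq'.pos
    rw [show (1 : ℝ) + 200 / (q : ℝ) ^ s.re = 1 + 200 * (q : ℝ) ^ (-s.re) by
      rw [Real.rpow_neg hq0.le, div_eq_mul_inv],
      abs_of_pos (by have := (rpow_neg_range hq' hs).1; positivity)]
    exact inv_quartic_le hq' hs

end KappaTilde

/-! ### §3. The node `Z22:§7.u046` -/

/-- **`Z22:§7.u046` DISCHARGED** (§7 p. 40, tex L2105): "By the simple bounds
`|κ̃(d₁;d₂k,s)| ≤ τ₅(d₁)∏_{q∣d₁}|1 + c/q^σ|`, `|λ(m,s)| ≤ ∏_{q∣m}|1 + c/q^σ|` for `σ > 9/10`" —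
as typed by `Section7dStatements.Step7u046` (an absolute `c`; here `c = 200`, uniformly in `D`,
`d₁, m ≥ 1`, `σ > 9/10`, and in the parameter `c′` of (2.13), since the shifts `β_j` are purely
imaginary). [cite: Zhang2022LandauSiegel, §7 p.40, tex L2105] -/
theorem _root_.Literature.NumberTheory.LFunctions.Zhang2022.Section7dStatements.step7u046_holds
    (c' : ℝ) : Section7dStatements.Step7u046 c' :=
  ⟨200, fun D _ m hd₁ _ _ hs =>
    ⟨norm_kappaTilde_le c' D hd₁.ne' m hs, norm_lam_le c' D m hs⟩⟩

variable (c' : ℝ) in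
/-- `Step7u046` — `_holds` alias of `step7u046_holds` above under the fact's exact name, stated under the
prover's own binders as section variables (appended 2026-08-28, D-0026 bookkeeping: the proof term is the
existing theorem of this file; no statement, definition or attribute is edited; no new named fact; the
ledger's debt table listed the fact unproved). [cite: Zhang2022LandauSiegel, §7 p.40, tex L2105] -/
theorem _root_.Literature.NumberTheory.LFunctions.Zhang2022.Section7dStatements.Step7u046_holds :
    _root_.Literature.NumberTheory.LFunctions.Zhang2022.Section7dStatements.Step7u046 c' :=
  _root_.Literature.NumberTheory.LFunctions.Zhang2022.Section7dStatements.step7u046_holds (c' := c')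

end Literature.NumberTheory.LFunctions.Zhang2022.KappaBounds
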